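import Summits.QuantumFields.BalabanUV.Beta.MultiscaleCubesGeometry

/-!
# Beta / MultiscaleParametrixGraded — NODE (w4-a′) CLOSED AT MODEL LEVEL: the hull count (G3) and THE END — the LEVEL-FREE parametrix of
# the multi-region operator holds for the cube-indexed partition of unity of ANY graded covering cell family with the thickness clause (TH)
# (MODEL; torus `UT N`)

INPUT (all DATA, as in `MultiscaleCubesGeometry`): the covering disjoint graded cube family, `M ≥ 1` (`M S_j ∣ N_i`, `2M S_j ≤ N_i`), the
adjacency count `n_adj`, the thickness clause (TH) with `R ≥ 4d + 6`; the operator data of `MultiscaleParametrixTorus.parametrix_torus_adapted`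
(`A = levelOp …` with cell-sum coercivity `C > 0`, isometric `Rm`, `T`, constant bond weight `c ≡ c₀`, print-size level weights `a_max`).
OUTPUT: §1 (G3) **`sum_cubeHull_le`**: at most `ν = n_adj·(2(2dL + d + 3) + 3)^d` hulls through a site — a hull through `x` belongs to an
ACTIVE box of a layer adjacent to the level of `x`'s cell (`MultiscaleCubesGeometry.adj_of_cellMeets`), with corner within `(2dL + d + 3)·M S_j`
of `x`; b05 `hnu_holds` counts the corners on each such grid; §2 **`parametrix_graded`** = `MultiscaleParametrixCubes.parametrix_cubes` BY NAME
with (C0)(C1)(C2)(G1)(G2)(G3) discharged: with `C_rem = remConst d |c₀| a_max C L K₁ (dK₂) (n_adj·d·K₁·L)` and **`C_rem·ν < M`**, `1 − R′` is a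
unit, `A⁻¹ = G′₀(1 − R′)⁻¹`, `‖(1 − R′)⁻¹‖_{ℓ²} ≤ (1 − C_remν/M)⁻¹` — «M sufficiently large» seeing `d, L, n_adj, c₀, a_max, C` ONLY.  This completes
node (w4-a′) of the O.2 skeleton (v1.5.2 §8.10): the scale-adapted parametrix is hypothesis-free at MODEL level in the ℓ² resolvent currency,
its geometric input being (TH) + the adjacency count (unit `b2b-balaban-beta-d4-p2`, GEN 10, MODEL crew).

HONEST FRAMING: discharging `BetaPertH` makes Bałaban's UV stability UNCONDITIONAL — NOT the continuum limit, NOT the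
Clay problem.  HONEST DEPENDENCY (verbatim): «continuum YM on T⁴ ⇐ BetaPertH ∧ nine spine estimates (0/9 proved);
BetaPertH ⇐ (D1) ∧ (D4) ∧ CAP+tail; G-an2-4 gates asym, D1 and NE2/3/4.»  THIS MODULE DISCHARGES NOTHING of `BetaPertH`,
asserts NOTHING printed and cites nothing as a fact (ABSOLUTE RULE): [folklore] assembly BY NAME; (TH) and the counts are DATA of
(2.1)–(2.2) SHAPE.  LOCI (shape only): [B5] = `Balaban1984PropagatorsI` (1.118) p. 37, p. 36 (ν); [B6] = `Balaban1984PropagatorsII`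
(2.1)–(2.2) p. 224, (2.36)–(2.40) pp. 229–230; [B9] = `Balaban1985BackgroundPropagators` (3.87)–(3.90) pp. 408–409, Thm 3.7.  No class
change on row D4 (width 0; D4 DISCHARGE NO DATE); NOT BetaPertH, NOT continuum, NOT Clay.
-/

namespace Summit.QuantumFields.BalabanUV.Beta.MultiscaleParametrixGraded

open Finset Function
open Summit.QuantumFields.BalabanUV.Beta.BoxPoincare (Box)
open Summit.QuantumFields.BalabanUV.Beta.MultiscaleCoerciveTorus
open Summit.QuantumFields.BalabanUV.Beta.MultiscaleDecayBudget
open Literature.MathematicalPhysics.QuantumFieldTheory.Balaban1983to89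
open B9Thm37Sum B9Thm37Glue B9Thm37GlueTorusInv
open Literature.MathematicalPhysics.QuantumFieldTheory.Balaban1983to89.B9Thm37GluePU (bsrc btgt bsrc_apply btgt_apply)
open Literature.MathematicalPhysics.QuantumFieldTheory.Balaban1983to89.B9Thm37GlueTorusCov (tblk)
open Literature.MathematicalPhysics.QuantumFieldTheory.Balaban1983to89.B9Thm37GlueTorusCovLevels (levelOp levelSum)
open B5TorusCover (UT Ctr ctrU hnu_holds)
open Summit.QuantumFields.BalabanUV.Beta.CovariantTowerL2
open Summit.QuantumFields.BalabanUV.Beta.MultiscaleRemainderLeibniz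
open Summit.QuantumFields.BalabanUV.Beta.MultiscaleParametrix
open Summit.QuantumFields.BalabanUV.Beta.MultiscaleParametrixTorus
open Summit.QuantumFields.BalabanUV.Beta.MultiscaleParametrixHull
open Summit.QuantumFields.BalabanUV.Beta.MultiscalePartitionNormalize
open Summit.QuantumFields.BalabanUV.Beta.MultiscalePartitionCubes
open Summit.QuantumFields.BalabanUV.Beta.MultiscaleCubesFamily
open Summit.QuantumFields.BalabanUV.Beta.MultiscaleParametrixCubes
open Summit.QuantumFields.BalabanUV.Beta.MultiscaleCubesGeometry
open Summit.QuantumFields.BalabanUV.Beta.MultiscaleParametrixBoxes (one_le_MS)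

noncomputable section

variable {d : ℕ} {N : Fin d → ℕ} [∀ i, NeZero (N i)] {Cp J K : Type} [Fintype Cp] [DecidableEq Cp] [Fintype J] [Fintype K]
  (S : J → ℕ) (hS : ∀ l, 1 ≤ S l) (hdivS : ∀ l i, S l ∣ N i) (lvl : K → J) (zc : (k : K) → Ctr N (S (lvl k)))
  (M : ℕ) (hM : 1 ≤ M) (hMdiv : ∀ j i, M * S j ∣ N i)

/-! ## §1 (G3): at most `ν = n_adj·(2(2dL + d + 3) + 3)^d` hulls through a site -/

section Count

variable {L : ℕ} {R : ℝ}

omit [Fintype K] in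
/-- **(G3) THE HULL COUNT**: under (TH) and the adjacency count, `Σ_p cubeHull_p(x) ≤ n_adj·(2(2dL + d + 3) + 3)^d` — a hull through `x`
belongs to an ACTIVE box of a layer adjacent to the level of `x`'s cell, with corner within `(2dL + d + 3)·M S_j` of `x`; b05 `hnu_holds`
counts the corners on each such grid. [cite: Balaban1984PropagatorsI, p.36 (ν); Balaban1984PropagatorsII, (2.37)-(2.38) p.229] -/
theorem sum_cubeHull_le [NeZero d]
    (hdisj : ∀ k k' v v', cellPt S hS hdivS lvl zc k v = cellPt S hS hdivS lvl zc k' v' → k = k')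
    (hcover : ∀ x : UT N, ∃ k, ∃ v : Box d (S (lvl k)), cellPt S hS hdivS lvl zc k v = x) (hR : 4 * (d : ℝ) + 6 ≤ R)
    (hthick : ∀ (k k' : K) (v : Box d (S (lvl k))) (v' : Box d (S (lvl k'))),
      dist (cellPt S hS hdivS lvl zc k v) (cellPt S hS hdivS lvl zc k' v') ≤ R * ((M : ℝ) * S (lvl k)) →
        S (lvl k) ≤ L * S (lvl k') ∧ S (lvl k') ≤ L * S (lvl k))
    {nadj : ℕ} (hadj : ∀ j, (univ.filter fun l => S j ≤ L * S l ∧ S l ≤ L * S j).card ≤ nadj) (x : UT N) :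
    ∑ p : Σ j : J, Ctr N (M * S j), cubeHull S hS hdivS lvl zc M hM hMdiv (gradedLayer S hS hdivS lvl zc M hM hMdiv) hcover p x ≤
      (nadj : ℝ) * (2 * (2 * d * L + d + 3) + 3) ^ d := by
  classical
  obtain ⟨k', v', hx⟩ := hcover x
  have hk' : cellOf S hS hdivS lvl zc hcover x = k' := by
    rw [← hx]; exact cellOf_cellPt S hS hdivS lvl zc hdisj hcover k' v'
  set cbar : ℝ := 2 * d * L + d + 3 with hcbar
  have hcbar0 : 0 ≤ cbar := by positivity
  have hB0 : (0 : ℝ) ≤ (2 * cbar + 3) ^ d := by positivity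
  have hM1 : (1 : ℝ) ≤ M := by exact_mod_cast hM
  -- pointwise indicator bound
  have hpt : ∀ (j : J) (z : Ctr N (M * S j)),
      cubeHull S hS hdivS lvl zc M hM hMdiv (gradedLayer S hS hdivS lvl zc M hM hMdiv) hcover ⟨j, z⟩ x ≤
        if (S (lvl k') ≤ L * S j ∧ S j ≤ L * S (lvl k')) ∧ dist x (ctrU N (M * S j) z) ≤ cbar * ((M * S j : ℕ) : ℝ) then 1 else 0 := by
    intro j z
    unfold cubeHull
    by_cases hact : ∃ y, cubeFam S hS M hM hMdiv (gradedLayer S hS hdivS lvl zc M hM hMdiv) ⟨j, z⟩ y ≠ 0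
    · rw [if_pos hact]
      unfold cellHull
      rw [hk']
      by_cases hmeet : CellMeets S hS hdivS lvl zc k' (ctrU N (M * S j) z) ((((d + 2) * (M * S j) : ℕ) : ℝ) + 1)
      · rw [if_pos hmeet]
        have hadjk := adj_of_cellMeets S hS hdivS lvl zc M hM hMdiv hR hthick j z hact k' hmeet
        obtain ⟨v'', hv''⟩ := hmeet
        have hSj1 : (1 : ℝ) ≤ S j := by exact_mod_cast hS j
        have hMS : ((M * S j : ℕ) : ℝ) = (M : ℝ) * S j := by push_cast; ring
        have hcast : ((((d + 2) * (M * S j) : ℕ)) : ℝ) = ((d : ℝ) + 2) * ((M : ℝ) * S j) := by push_cast; ring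
        have hMS1 : (1 : ℝ) ≤ (M : ℝ) * S j := by
          have h1 := one_le_MS S hS hM j
          rw [← hMS]; exact_mod_cast h1
        have hSk : ((S (lvl k') : ℕ) : ℝ) ≤ L * S j := by exact_mod_cast hadjk.2
        have hdiam : dist x (cellPt S hS hdivS lvl zc k' v'') ≤ 2 * (d * ((L : ℝ) * S j)) := by
          have h := dist_cellPt_cellPt_le S hS hdivS lvl zc k' v' v''
          rw [hx] at h
          refine h.trans (mul_le_mul_of_nonneg_left ?_ (by norm_num))
          have h3 : ((d * (S (lvl k') - 1) : ℕ) : ℝ) ≤ d * (S (lvl k') : ℝ) := by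
            have : d * (S (lvl k') - 1) ≤ d * S (lvl k') := Nat.mul_le_mul_left d (Nat.sub_le _ _)
            exact_mod_cast this
          exact h3.trans (mul_le_mul_of_nonneg_left hSk (Nat.cast_nonneg _))
        have hnear : dist x (ctrU N (M * S j) z) ≤ cbar * ((M * S j : ℕ) : ℝ) := by
          rw [hMS, hcbar]
          rw [hcast] at hv''
          have hSMS : (S j : ℝ) ≤ (M : ℝ) * S j := le_mul_of_one_le_left (Nat.cast_nonneg _) hM1
          have hdL0 : (0 : ℝ) ≤ 2 * d * L := by positivity
          have h4 : 2 * d * L * (S j : ℝ) ≤ 2 * d * L * ((M : ℝ) * S j) := mul_le_mul_of_nonneg_left hSMS hdL0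
          calc dist x (ctrU N (M * S j) z) ≤ dist x (cellPt S hS hdivS lvl zc k' v'') + dist (cellPt S hS hdivS lvl zc k' v'') (ctrU N (M * S j) z) :=
                dist_triangle _ _ _
            _ ≤ 2 * (d * ((L : ℝ) * S j)) + (((d : ℝ) + 2) * ((M : ℝ) * S j) + 1) := add_le_add hdiam hv''
            _ ≤ (2 * d * L + d + 3) * ((M : ℝ) * S j) := by linarith
        rw [if_pos ⟨⟨hadjk.2, hadjk.1⟩, hnear⟩]
      · rw [if_neg hmeet]; split_ifs <;> norm_num
    · rw [if_neg hact]; split_ifs <;> norm_num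
  -- per-level count by b05 `hnu_holds`
  have hlev : ∀ j : J, ∑ z : Ctr N (M * S j),
      (if (S (lvl k') ≤ L * S j ∧ S j ≤ L * S (lvl k')) ∧ dist x (ctrU N (M * S j) z) ≤ cbar * ((M * S j : ℕ) : ℝ) then (1 : ℝ) else 0) ≤
        if S (lvl k') ≤ L * S j ∧ S j ≤ L * S (lvl k') then (2 * cbar + 3) ^ d else 0 := by
    intro j
    by_cases hA : S (lvl k') ≤ L * S j ∧ S j ≤ L * S (lvl k')
    · rw [if_pos hA]
      have e : ∑ z : Ctr N (M * S j),
          (if (S (lvl k') ≤ L * S j ∧ S j ≤ L * S (lvl k')) ∧ dist x (ctrU N (M * S j) z) ≤ cbar * ((M * S j : ℕ) : ℝ) then (1 : ℝ) else 0) =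
          ∑ z : Ctr N (M * S j), (if dist x (ctrU N (M * S j) z) ≤ cbar * ((M * S j : ℕ) : ℝ) then (1 : ℝ) else 0) :=
        Finset.sum_congr rfl fun z _ => by simp only [hA, true_and]
      rw [e, Finset.sum_boole]
      exact hnu_holds (N := N) (one_le_MS S hS hM j) hcbar0 x
    · rw [if_neg hA]
      simp only [hA, false_and, if_false, Finset.sum_const_zero, le_refl]
  calc ∑ p : Σ j : J, Ctr N (M * S j), cubeHull S hS hdivS lvl zc M hM hMdiv (gradedLayer S hS hdivS lvl zc M hM hMdiv) hcover p x
      = ∑ j, ∑ z : Ctr N (M * S j), cubeHull S hS hdivS lvl zc M hM hMdiv (gradedLayer S hS hdivS lvl zc M hM hMdiv) hcover ⟨j, z⟩ x :=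
        Fintype.sum_sigma _
    _ ≤ ∑ j, ∑ z : Ctr N (M * S j),
          (if (S (lvl k') ≤ L * S j ∧ S j ≤ L * S (lvl k')) ∧ dist x (ctrU N (M * S j) z) ≤ cbar * ((M * S j : ℕ) : ℝ) then (1 : ℝ) else 0) :=
        Finset.sum_le_sum fun j _ => Finset.sum_le_sum fun z _ => hpt j z
    _ ≤ ∑ j, (if S (lvl k') ≤ L * S j ∧ S j ≤ L * S (lvl k') then (2 * cbar + 3) ^ d else 0) := Finset.sum_le_sum fun j _ => hlev j
    _ = ((univ.filter fun j => S (lvl k') ≤ L * S j ∧ S j ≤ L * S (lvl k')).card : ℝ) * (2 * cbar + 3) ^ d := by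
        rw [Finset.sum_ite, Finset.sum_const_zero, add_zero, Finset.sum_const, nsmul_eq_mul]
    _ ≤ (nadj : ℝ) * (2 * cbar + 3) ^ d := mul_le_mul_of_nonneg_right (by exact_mod_cast hadj (lvl k')) hB0
    _ = (nadj : ℝ) * (2 * (2 * d * L + d + 3) + 3) ^ d := by rw [hcbar]

end Count

/-! ## §2 THE END: the level-free parametrix for ANY graded covering cell family with thickness -/

section End

variable (Rm : UT N × Fin d → Cp → Cp → ℝ) (T : J → UT N → Cp → Cp → ℝ) (a : J → ℝ) (ω : J → UT N → ℝ)
  (c : UT N × Fin d → ℝ)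

/-- **THE SCALE-ADAPTED PARAMETRIX OF THE MULTI-REGION OPERATOR, HYPOTHESIS-FREE AT MODEL LEVEL (node (w4-a′) CLOSED in the ℓ² currency).**
For ANY covering disjoint graded cube family on the torus with the thickness clause (TH) (`R ≥ 4d + 6`) and at most `n_adj` adjacent levels per
level, the operator `A = levelOp …` with cell-sum coercivity `C > 0`, constant bond weight `c ≡ c₀`, print-size level weights, `M ≥ 1` with
`M S_j ∣ N_i`, `2M S_j ≤ N_i`, and **`C_rem·ν < M`** where `ν = n_adj·(2(2dL + d + 3) + 3)^d`,
`C_rem = remConst d |c₀| a_max C L K₁ (d·K₂) (n_adj·d·K₁·L)`: for the cube-indexed partition of unity `cubeFam` of the layer predicate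
`gradedLayer` and its hulls, `1 − R′` is a unit, **`A⁻¹ = G′₀·(1 − R′)⁻¹`** and **`‖(1 − R′)⁻¹‖_{ℓ²} ≤ (1 − C_remν/M)⁻¹`** — «M sufficiently
large» depending on `d, L, n_adj, c₀, a_max, C` ONLY ([B9] Thm 3.7 / [B6] (2.38) SHAPE).
[cite: Balaban1985BackgroundPropagators, (3.87)–(3.90) pp.408–409 + Thm 3.7; Balaban1984PropagatorsII, (2.1)-(2.2) p.224 + (2.36)–(2.40) pp.229–230; Balaban1984PropagatorsI, (1.118) p.37] -/
theorem parametrix_graded [NeZero d]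
    (hdisj : ∀ k k' v v', cellPt S hS hdivS lvl zc k v = cellPt S hS hdivS lvl zc k' v' → k = k')
    (hcover : ∀ x : UT N, ∃ k, ∃ v : Box d (S (lvl k)), cellPt S hS hdivS lvl zc k v = x)
    (hRm : ∀ b i j, ∑ k, Rm b k i * Rm b k j = if i = j then (1 : ℝ) else 0)
    (hT : ∀ l x i i', ∑ k, T l x k i * T l x k i' = if i = i' then (1 : ℝ) else 0) (ha : ∀ j, 0 ≤ a j)
    (hsupp : ∀ l x, ω l (ctrU N (S l) (tblk (hS l) (hdivS l) x)) ≠ 0 → ∃ k v, lvl k = l ∧ cellPt S hS hdivS lvl zc k v = x)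
    {wmax : J → ℝ} (hw0 : ∀ l, 0 ≤ wmax l) (hw : ∀ l x, |ω l (ctrU N (S l) (tblk (hS l) (hdivS l) x))| ≤ wmax l)
    {amax : ℝ} (hamax : 0 ≤ amax) (hscaleW : ∀ l, |a l| * (wmax l ^ 2 * ((S l ^ d : ℕ) : ℝ)) ≤ amax / (S l : ℝ) ^ 2)
    {c₀ : ℝ} (hc : ∀ b, c b = c₀) {C : ℝ} (hC : 0 < C)
    (hcoer : ∀ f : UT N × Cp → ℝ,
      C * ∑ k, ((S (lvl k) : ℝ) ^ 2)⁻¹ * ∑ v : Box d (S (lvl k)), ∑ i, f (cellPt S hS hdivS lvl zc k v, i) ^ 2 ≤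
        ∑ p, f p * levelOp bsrc btgt c Rm (fun l x => ctrU N (S l) (tblk (hS l) (hdivS l) x))
          (fun l x => ω l (ctrU N (S l) (tblk (hS l) (hdivS l) x))) T a f p)
    (h2N : ∀ j i, 2 * (M * S j) ≤ N i) (L : ℕ) (hL : 1 ≤ L) {nadj : ℕ}
    (hadj : ∀ j, (univ.filter fun l => S j ≤ L * S l ∧ S l ≤ L * S j).card ≤ nadj) {R : ℝ} (hR : 4 * (d : ℝ) + 6 ≤ R)
    (hthick : ∀ (k k' : K) (v : Box d (S (lvl k))) (v' : Box d (S (lvl k'))),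
      dist (cellPt S hS hdivS lvl zc k v) (cellPt S hS hdivS lvl zc k' v') ≤ R * ((M : ℝ) * S (lvl k)) →
        S (lvl k) ≤ L * S (lvl k') ∧ S (lvl k') ≤ L * S (lvl k))
    (hsmall : remConst d |c₀| amax C L (K1 d L nadj) (d * K2 d L nadj) (nadj * d * K1 d L nadj * L) / M *
      ((nadj : ℝ) * (2 * (2 * d * L + d + 3) + 3) ^ d) < 1) :
    IsUnit (1 - Rsum bsrc btgt c Rm
        (levelSum (fun l x => ctrU N (S l) (tblk (hS l) (hdivS l) x)) (fun l x => ω l (ctrU N (S l) (tblk (hS l) (hdivS l) x))) T a)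
        (levelOp bsrc btgt c Rm (fun l x => ctrU N (S l) (tblk (hS l) (hdivS l) x))
          (fun l x => ω l (ctrU N (S l) (tblk (hS l) (hdivS l) x))) T a)
        (cubeFam S hS M hM hMdiv (gradedLayer S hS hdivS lvl zc M hM hMdiv))
        (cubeHull S hS hdivS lvl zc M hM hMdiv (gradedLayer S hS hdivS lvl zc M hM hMdiv) hcover)) ∧
      Ring.inverse (levelOp bsrc btgt c Rm (fun l x => ctrU N (S l) (tblk (hS l) (hdivS l) x))
          (fun l x => ω l (ctrU N (S l) (tblk (hS l) (hdivS l) x))) T a) =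
        G0sum (levelOp bsrc btgt c Rm (fun l x => ctrU N (S l) (tblk (hS l) (hdivS l) x))
          (fun l x => ω l (ctrU N (S l) (tblk (hS l) (hdivS l) x))) T a)
          (cubeFam S hS M hM hMdiv (gradedLayer S hS hdivS lvl zc M hM hMdiv))
          (cubeHull S hS hdivS lvl zc M hM hMdiv (gradedLayer S hS hdivS lvl zc M hM hMdiv) hcover) *
        Ring.inverse (1 - Rsum bsrc btgt c Rm
          (levelSum (fun l x => ctrU N (S l) (tblk (hS l) (hdivS l) x)) (fun l x => ω l (ctrU N (S l) (tblk (hS l) (hdivS l) x))) T a)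
          (levelOp bsrc btgt c Rm (fun l x => ctrU N (S l) (tblk (hS l) (hdivS l) x))
            (fun l x => ω l (ctrU N (S l) (tblk (hS l) (hdivS l) x))) T a)
          (cubeFam S hS M hM hMdiv (gradedLayer S hS hdivS lvl zc M hM hMdiv))
          (cubeHull S hS hdivS lvl zc M hM hMdiv (gradedLayer S hS hdivS lvl zc M hM hMdiv) hcover)) ∧
      L2Bound (Ring.inverse (1 - Rsum bsrc btgt c Rm
          (levelSum (fun l x => ctrU N (S l) (tblk (hS l) (hdivS l) x)) (fun l x => ω l (ctrU N (S l) (tblk (hS l) (hdivS l) x))) T a)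
          (levelOp bsrc btgt c Rm (fun l x => ctrU N (S l) (tblk (hS l) (hdivS l) x))
            (fun l x => ω l (ctrU N (S l) (tblk (hS l) (hdivS l) x))) T a)
          (cubeFam S hS M hM hMdiv (gradedLayer S hS hdivS lvl zc M hM hMdiv))
          (cubeHull S hS hdivS lvl zc M hM hMdiv (gradedLayer S hS hdivS lvl zc M hM hMdiv) hcover)))
        (1 - remConst d |c₀| amax C L (K1 d L nadj) (d * K2 d L nadj) (nadj * d * K1 d L nadj * L) / M *
          ((nadj : ℝ) * (2 * (2 * d * L + d + 3) + 3) ^ d))⁻¹ := by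
  classical
  exact parametrix_cubes S hS hdivS lvl zc M hM hMdiv (gradedLayer S hS hdivS lvl zc M hM hMdiv) Rm T a ω c hdisj hcover hRm hT ha
    hsupp hw0 hw hamax hscaleW hc hC hcoer h2N L hL (gradedLayer_cover S hS hdivS lvl zc M hM hMdiv hcover)
    (scales_cmp_of_rawFam_ne_zero S hS hdivS lvl zc M hM hMdiv hL hR hthick)
    (card_layers_le S hS hdivS lvl zc M hM hMdiv hcover hR hthick hadj)
    (cubeFam_cellPt_eq_zero S hS hdivS lvl zc M hM hMdiv hR hthick) hadj
    (fun j z hact k hk => (adj_of_cellMeets S hS hdivS lvl zc M hM hMdiv hR hthick j z hact k hk).2)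
    (by positivity) (sum_cubeHull_le S hS hdivS lvl zc M hM hMdiv hdisj hcover hR hthick hadj) hsmall

end End

end

end Summit.QuantumFields.BalabanUV.Beta.MultiscaleParametrixGraded
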